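import Mathlib
import Summits.ValiantsHypothesis.ValiantsHypothesis.Theorems.BarrierLeverSuccinctHittingSetsForVPDimensionCount
import HarnessLib

/-!
# Item `BarrierLever.NaturalProofsSeparateVNP` (stmt-ValiantsHypothesis-18972), SIGN SLICE —
# part 10: the pigeonhole threshold for the AS-PRINTED CKRST 2020 Thm. 1.1 (size schedule `n^{log n}`)

Pure arithmetic for the as-printed form of CKRST 2020 Thm. 1.1 (degree `d = n^c`, ONE family of
equations serving every size exponent `k`, hence a barely super-polynomial size schedule
`s(n) = n^{⌊log₂ n⌋}` as in CKRST §4, "`s_n = n^{log n}`"). With `N = C(n + d, d)` coefficient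
variables and the hitting-point coordinate bound
`B = (4 d C(n+d,d) + 1)^(9376 (n+d+s+4)^21) · d + 1` of part 9, the Siegel/Chinese-remaindering
steps need `N · B^d + 1 < 2^N`; since `log₂ B` is quasi-polynomial in `n` while `N ≥ 2^n`, this
holds for `n ≥ n₀(c)`:

* `AsPrintedBounds.threshold` — `∃ n₀, ∀ n ≥ n₀, 6 ≤ n ∧ N · B^d + 1 < 2^N` (with `d = n^c`,
  `s = n^{Nat.log 2 n}`).

All bounds are crude powers of two in `E = (c+1)(⌊log₂ n⌋+1)²`; the final comparison
`23 E + 61 ≤ 2^{⌊log₂ n⌋}` is `LowDegreeEquations.eventually_mul_pow_le_two_pow`.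

References: [ChatterjeeKumarRamyaSaptharishiTengse2020] §4 (choice of `s_n`, "remark on the largeness").
-/

-- layout Summits/ValiantsHypothesis/ValiantsHypothesis forces the duplicated namespace component
set_option linter.dupNamespace false

namespace Summit.ValiantsHypothesis.ValiantsHypothesis.Theorems.BarrierLever.NaturalProofsSeparateVNP

open Summit.ValiantsHypothesis.ValiantsHypothesis.Theorems.BarrierLever.SuccinctHittingSetsForVP

namespace AsPrintedBounds

/-! ### Bookkeeping with powers of two -/

/-- `a ≤ 2^x`, `b ≤ 2^y` ⇒ `a b ≤ 2^(x+y)`. [folklore] -/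
theorem mul_le_two_pow {a b x y : ℕ} (ha : a ≤ 2 ^ x) (hb : b ≤ 2 ^ y) : a * b ≤ 2 ^ (x + y) := by
  rw [pow_add]; exact Nat.mul_le_mul ha hb

/-- `a ≤ 2^x`, `b ≤ 2^x` ⇒ `a + b ≤ 2^(x+1)`. [folklore] -/
theorem add_le_two_pow {a b x : ℕ} (ha : a ≤ 2 ^ x) (hb : b ≤ 2 ^ x) : a + b ≤ 2 ^ (x + 1) := by
  rw [pow_succ]; omega

/-- `a ≤ 2^x` ⇒ `a + 1 ≤ 2^(x+1)`. [folklore] -/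
theorem succ_le_two_pow {a x : ℕ} (ha : a ≤ 2 ^ x) : a + 1 ≤ 2 ^ (x + 1) :=
  add_le_two_pow ha Nat.one_le_two_pow

/-- `a ≤ 2^x` ⇒ `a^k ≤ 2^(x k)`. [folklore] -/
theorem pow_le_two_pow {a x : ℕ} (ha : a ≤ 2 ^ x) (k : ℕ) : a ^ k ≤ 2 ^ (x * k) := by
  rw [pow_mul]; exact Nat.pow_le_pow_left ha k

/-- Monotonicity of `2^·`. [folklore] -/
theorem two_pow_mono {x y : ℕ} (h : x ≤ y) : 2 ^ x ≤ 2 ^ y := Nat.pow_le_pow_right (by norm_num) h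

/-- `x + 3 ≤ 2^(x+2)`. [folklore] -/
theorem add_three_le_two_pow (x : ℕ) : x + 3 ≤ 2 ^ (x + 2) := by
  have := @Nat.lt_two_pow_self x
  rw [pow_add]; omega

/-! ### The quantities of the construction, bounded in `E = (c+1)(L+1)²`, `L = ⌊log₂ n⌋` -/

section Bounds

variable {c n : ℕ}

/-- `n < 2^(L+1)`, `L = ⌊log₂ n⌋`. [folklore] -/
theorem lt_two_pow_log_succ (n : ℕ) : n < 2 ^ (Nat.log 2 n + 1) :=
  Nat.lt_pow_succ_log_self (by norm_num) n

/-- `(c+1)(L+1)² ≥ c(L+1)`, `≥ L(L+1)`, `≥ L+1`. [folklore] -/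
theorem exps_le (c L : ℕ) :
    c * (L + 1) ≤ (c + 1) * (L + 1) ^ 2 ∧ L * (L + 1) ≤ (c + 1) * (L + 1) ^ 2 ∧
      L + 1 ≤ (c + 1) * (L + 1) ^ 2 := by
  have hsq : L + 1 ≤ (L + 1) ^ 2 := Nat.le_self_pow (by norm_num) _
  have h3 : (L + 1) ^ 2 ≤ (c + 1) * (L + 1) ^ 2 := Nat.le_mul_of_pos_left _ (Nat.succ_pos c)
  refine ⟨Nat.mul_le_mul (Nat.le_succ c) hsq, ?_, hsq.trans h3⟩
  calc L * (L + 1) ≤ (L + 1) * (L + 1) := Nat.mul_le_mul_right _ (Nat.le_succ L)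
    _ = (L + 1) ^ 2 := (pow_two _).symm
    _ ≤ (c + 1) * (L + 1) ^ 2 := h3

/-- `x + 3 ≤ 2^(x+1)` for `x ≥ 1`. [folklore] -/
theorem add_three_le_two_pow_succ {x : ℕ} (hx : 1 ≤ x) : x + 3 ≤ 2 ^ (x + 1) := by
  have := @Nat.lt_two_pow_self x
  rw [pow_succ]; omega

/-- `n ≤ 2^E`, `n^c ≤ 2^E`, `n^L ≤ 2^E` for `E = (c+1)(L+1)²`. [folklore] -/
theorem basic_le (c n : ℕ) :
    n ≤ 2 ^ ((c + 1) * (Nat.log 2 n + 1) ^ 2) ∧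
      n ^ c ≤ 2 ^ ((c + 1) * (Nat.log 2 n + 1) ^ 2) ∧
      n ^ Nat.log 2 n ≤ 2 ^ ((c + 1) * (Nat.log 2 n + 1) ^ 2) := by
  set L := Nat.log 2 n with hL
  obtain ⟨h1, h2, h3⟩ := exps_le c L
  have hn : n ≤ 2 ^ (L + 1) := (lt_two_pow_log_succ n).le
  refine ⟨hn.trans (two_pow_mono h3), ?_, ?_⟩
  · exact (pow_le_two_pow hn c).trans (two_pow_mono (by rw [mul_comm]; exact h1))
  · exact (pow_le_two_pow hn L).trans (two_pow_mono (by rw [mul_comm]; exact h2))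

/-- The parameter count: `9376 (n + d + s + 4)^21 ≤ 2^(21 E + 56)`. [folklore] -/
theorem params_le {E n d s : ℕ} (hn : n ≤ 2 ^ E) (hd : d ≤ 2 ^ E) (hs : s ≤ 2 ^ E) (hE : 2 ≤ E) :
    9376 * (n + d + s + 4) ^ 21 ≤ 2 ^ (21 * E + 56) := by
  have h4 : 4 ≤ 2 ^ E := le_trans (by norm_num) (two_pow_mono hE : 2 ^ 2 ≤ 2 ^ E)
  have hX : n + d + s + 4 ≤ 2 ^ (E + 2) := by rw [pow_add]; omega
  have h1 : (n + d + s + 4) ^ 21 ≤ 2 ^ ((E + 2) * 21) := pow_le_two_pow hX 21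
  have h2 : (9376 : ℕ) ≤ 2 ^ 14 := by norm_num
  calc 9376 * (n + d + s + 4) ^ 21 ≤ 2 ^ 14 * 2 ^ ((E + 2) * 21) := Nat.mul_le_mul h2 h1
    _ = 2 ^ (21 * E + 56) := by rw [← pow_add]; ring_nf

/-- The base of the zero-pattern bound: `4 d C(n+d,d) + 1 ≤ 2^G`, `G = E + 3 + 2^(E+1)`, and
`G ≤ 2^(E+2)` (`E ≥ 1`). [folklore] -/
theorem base_le {E n d : ℕ} (hn : n ≤ 2 ^ E) (hd : d ≤ 2 ^ E) (hE : 1 ≤ E) :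
    4 * d * (n + d).choose d + 1 ≤ 2 ^ (E + 3 + 2 ^ (E + 1)) ∧
      E + 3 + 2 ^ (E + 1) ≤ 2 ^ (E + 2) := by
  have hC : (n + d).choose d ≤ 2 ^ (n + d) := Nat.choose_le_two_pow _ _
  have hnd : n + d ≤ 2 ^ (E + 1) := add_le_two_pow hn hd
  have hC' : (n + d).choose d ≤ 2 ^ (2 ^ (E + 1)) := hC.trans (two_pow_mono hnd)
  have h4d : 4 * d ≤ 2 ^ (E + 2) := by rw [pow_add]; omega
  refine ⟨?_, ?_⟩
  · have h := succ_le_two_pow (mul_le_two_pow h4d hC')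
    exact h.trans (two_pow_mono (le_of_eq (by ring)))
  · have h1 := add_three_le_two_pow_succ hE
    have h2 : 2 ^ (E + 2) = 2 ^ (E + 1) + 2 ^ (E + 1) := by rw [pow_succ]; ring
    rw [h2]; exact Nat.add_le_add_right h1 _

/-- **The pigeonhole inequality, abstract form.** With `n, d, s ≤ 2^E`, `E ≥ 2`, `1 ≤ d`,
`p ≤ 9376 (n+d+s+4)^21`, and `N = C(n+d, d)`:
`N · ((4 d N + 1)^p · d + 1)^d + 1 ≤ 2^(2^(23 E + 60))`. [folklore] -/
theorem main_le {E n d s p : ℕ} (hn : n ≤ 2 ^ E) (hd : d ≤ 2 ^ E) (hs : s ≤ 2 ^ E) (hE : 2 ≤ E)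
    (hp : p ≤ 9376 * (n + d + s + 4) ^ 21) :
    (n + d).choose d * ((4 * d * (n + d).choose d + 1) ^ p * d + 1) ^ d + 1 ≤
      2 ^ (2 ^ (23 * E + 60)) := by
  obtain ⟨hbase, hG⟩ := base_le hn hd (by omega)
  set G := E + 3 + 2 ^ (E + 1) with hGdef
  have hp' : p ≤ 2 ^ (21 * E + 56) := hp.trans (params_le hn hd hs hE)
  -- Z = base^p ≤ 2^(G p), G p ≤ 2^(22E+58)
  have hZ : (4 * d * (n + d).choose d + 1) ^ p ≤ 2 ^ (G * p) := pow_le_two_pow hbase p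
  have hGp : G * p ≤ 2 ^ (22 * E + 58) := by
    calc G * p ≤ 2 ^ (E + 2) * 2 ^ (21 * E + 56) := Nat.mul_le_mul hG hp'
      _ = 2 ^ (22 * E + 58) := by rw [← pow_add]; ring_nf
  -- B ≤ 2^(Gp + E + 1) =: 2^H, H ≤ 2^(22E+59)
  have hB : (4 * d * (n + d).choose d + 1) ^ p * d + 1 ≤ 2 ^ (G * p + E + 1) :=
    succ_le_two_pow (mul_le_two_pow hZ hd)
  have hH : G * p + E + 1 ≤ 2 ^ (22 * E + 59) := by
    have h1 : E + 1 ≤ 2 ^ (22 * E + 58) := by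
      have := @Nat.lt_two_pow_self (E + 1)
      exact this.le.trans (two_pow_mono (by omega))
    have := add_le_two_pow hGp h1
    simpa [add_assoc] using this
  -- B^d ≤ 2^(H d), H d ≤ 2^(23E+59)
  have hBd : ((4 * d * (n + d).choose d + 1) ^ p * d + 1) ^ d ≤ 2 ^ ((G * p + E + 1) * d) :=
    pow_le_two_pow hB d
  have hHd : (G * p + E + 1) * d ≤ 2 ^ (23 * E + 59) := by
    calc (G * p + E + 1) * d ≤ 2 ^ (22 * E + 59) * 2 ^ E := Nat.mul_le_mul hH hd
      _ = 2 ^ (23 * E + 59) := by rw [← pow_add]; ring_nf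
  -- N ≤ 2^(2^(E+1))
  have hN : (n + d).choose d ≤ 2 ^ (2 ^ (E + 1)) :=
    (Nat.choose_le_two_pow _ _).trans (two_pow_mono (add_le_two_pow hn hd))
  have h2E : 2 ^ (E + 1) < 2 ^ (23 * E + 59) := Nat.pow_lt_pow_right (by norm_num) (by omega)
  -- assemble
  have hprod : (n + d).choose d * ((4 * d * (n + d).choose d + 1) ^ p * d + 1) ^ d ≤
      2 ^ (2 ^ (E + 1) + 2 ^ (23 * E + 59)) :=
    mul_le_two_pow hN (hBd.trans (two_pow_mono hHd))
  have hfin := succ_le_two_pow hprod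
  refine hfin.trans (two_pow_mono ?_)
  have : 2 ^ (23 * E + 60) = 2 ^ (23 * E + 59) + 2 ^ (23 * E + 59) := by rw [pow_succ]; ring
  omega

end Bounds

/-! ### The threshold -/

/-- `23 (c+1) (L+1)² + 61 ≤ 2^L` for `L ≥ L₀(c)`. [folklore] -/
theorem exists_log_threshold (c : ℕ) :
    ∃ L₀ : ℕ, ∀ L : ℕ, L₀ ≤ L → 23 * ((c + 1) * (L + 1) ^ 2) + 61 ≤ 2 ^ L := by
  obtain ⟨L₀, hL₀⟩ := LowDegreeEquations.eventually_mul_pow_le_two_pow (92 * (c + 1) + 61) 2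
  refine ⟨max L₀ 1, fun L hL => ?_⟩
  have hL1 : 1 ≤ L := le_of_max_le_right hL
  have h := hL₀ L (le_of_max_le_left hL)
  have hL2 : L ≤ L ^ 2 := Nat.le_self_pow (by norm_num) _
  have h1 : (c + 1) * L ≤ (c + 1) * L ^ 2 := Nat.mul_le_mul_left _ hL2
  have h2 : c + 1 ≤ (c + 1) * L ^ 2 := Nat.le_mul_of_pos_right _ (by positivity)
  have h3 : 1 ≤ L ^ 2 := Nat.one_le_pow _ _ hL1
  have : 23 * ((c + 1) * (L + 1) ^ 2) + 61 ≤ (92 * (c + 1) + 61) * L ^ 2 := by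
    have expand : 23 * ((c + 1) * (L + 1) ^ 2) + 61 =
        23 * ((c + 1) * L ^ 2) + 46 * ((c + 1) * L) + 23 * (c + 1) + 61 := by ring
    have expand2 : (92 * (c + 1) + 61) * L ^ 2 = 92 * ((c + 1) * L ^ 2) + 61 * L ^ 2 := by ring
    rw [expand, expand2]
    linarith
  exact this.trans h

/-- **Threshold for the as-printed construction.** For `n ≥ n₀(c)`: `n ≥ 6` and, with `d = n^c`,
`s = n^{⌊log₂ n⌋}`, `N = C(n+d, d)`, `B = (4 d N + 1)^(9376 (n+d+s+4)^21) · d + 1` (the hitting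
bound of part 9), every `p ≤ 9376 (n+d+s+4)^21` gives `N · ((4 d N + 1)^p d + 1)^d + 1 < 2^N`; in
particular `N · B^d + 1 < 2^N`. [cite: ChatterjeeKumarRamyaSaptharishiTengse2020, §4] -/
theorem threshold (c : ℕ) (hc : 1 ≤ c) : ∃ n₀ : ℕ, ∀ n : ℕ, n₀ ≤ n → 6 ≤ n ∧
    (n + n ^ c).choose (n ^ c) *
        ((4 * n ^ c * (n + n ^ c).choose (n ^ c) + 1) ^
            (9376 * (n + n ^ c + n ^ Nat.log 2 n + 4) ^ 21) * n ^ c + 1) ^ (n ^ c) + 1 <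
      2 ^ (n + n ^ c).choose (n ^ c) := by
  obtain ⟨L₀, hL₀⟩ := exists_log_threshold c
  refine ⟨max (2 ^ L₀) 6, fun n hn => ?_⟩
  have hn6 : 6 ≤ n := le_of_max_le_right hn
  have hnL : 2 ^ L₀ ≤ n := le_of_max_le_left hn
  refine ⟨hn6, ?_⟩
  set L := Nat.log 2 n with hLdef
  set E := (c + 1) * (L + 1) ^ 2 with hEdef
  have hL0 : L₀ ≤ L := by
    rw [hLdef]; exact Nat.le_log_of_pow_le (by norm_num) hnL
  have hkey := hL₀ L hL0
  obtain ⟨hnE, hdE, hsE⟩ := basic_le c n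
  have hE2 : 2 ≤ E := by rw [hEdef]; nlinarith
  have hmain := main_le (p := 9376 * (n + n ^ c + n ^ Nat.log 2 n + 4) ^ 21) hnE hdE hsE hE2 le_rfl
  -- 2^(23E+60) < N, since 23E+60 < 2^L ≤ n ≤ 2^n ≤ C(2n,n) ≤ C(n+d,d)... via N ≥ 2^n
  have hpowL : 2 ^ L ≤ n := by rw [hLdef]; exact Nat.pow_log_le_self 2 (by omega)
  have hexp : 23 * E + 60 < n := by rw [hEdef]; omega
  have hN : 2 ^ n ≤ (n + n ^ c).choose (n ^ c) := by
    have h1 : 2 ^ n ≤ (2 * n).choose n := LowDegreeEquations.two_pow_le_choose (by omega)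
    have h2 : (2 * n).choose n ≤ (n + n ^ c).choose n := by
      refine Nat.choose_le_choose n ?_
      have : n ≤ n ^ c := by
        calc n = n ^ 1 := (pow_one n).symm
          _ ≤ n ^ c := Nat.pow_le_pow_right (by omega) hc
      omega
    have h3 : (n + n ^ c).choose n = (n + n ^ c).choose (n ^ c) := by
      rw [Nat.choose_symm_add]
    rw [← h3]; exact h1.trans h2
  refine lt_of_le_of_lt hmain ?_
  calc 2 ^ (2 ^ (23 * E + 60)) < 2 ^ (2 ^ n) :=
        Nat.pow_lt_pow_right (by norm_num) (Nat.pow_lt_pow_right (by norm_num) hexp)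
    _ ≤ 2 ^ (n + n ^ c).choose (n ^ c) := two_pow_mono hN

end AsPrintedBounds

end Summit.ValiantsHypothesis.ValiantsHypothesis.Theorems.BarrierLever.NaturalProofsSeparateVNP
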